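import Summits.ResolutionOfSingularities.ResolutionOfSingularities.Theorems.FrobeniusClosingSteerEtaleTowerLevels
import Summits.ResolutionOfSingularities.ResolutionOfSingularities.Theorems.FrobeniusClosingSteerRadicandCohenFrame
import Mathlib.FieldTheory.SeparableDegree
import HarnessLib

/-!
# [OURS · L0 W4.1] K3ᴳ (F5a): the RESIDUE TOWER of a geometric chain — finite separable `κ(S M)/κ(S 0)` from «rational ∨ residue basis of size 3»,
# the compatible maps `ψ m : κ(S m) → κ(⨆ S m)`, and the stage-A′ datum `(P, θ)` with the coefficient read-off below the horizon
# (chain W4.1 `FrobeniusClosingSteer`, crux stmt-ResolutionOfSingularities-16345; K3ᴳ = `K3GTarget.horizonBaseChange`, res-L0-w41-stub-2 signature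
# 8151858124874f54; `--supports … --as helper`)

HONEST FRAMING. OURS kernel (HIRONAKA-L librarian res-D-lib-1 gen 8). Inputs of `EtaleTower.exists_chain_lift` (`…EtaleTowerField`) produced from the
K3ᴳ word's per-step dichotomy «the step is residually rational, or `κ(S (m+1))` has a residue basis of size 3 over `κ(S m)`»:
* §1 field lemmas: `finite_and_isSeparable_of_surjective`; **`isSeparable_of_odd_finrank`** (characteristic 2: an inseparable minimal polynomial is a
  polynomial in `X²`, of even degree dividing the odd `[E:F]`); `finite_and_finrank_of_residue_basis` (a residue basis of size `q` ⟹ `[κ₁:κ₀] = q`);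
* §2 **`finite_isSeparable_residueField_chain`** — `κ(S m)/κ(S 0)` is finite separable for every `m` (Mathlib's residue-field algebras of the local
  inclusions, `Module.Finite.trans`, `Algebra.IsSeparable.trans`);
* §3 **`exists_compat_root`** — a field `k′` (`= κ(⨆ S m)`), compatible `ψ m : κ(S m) → k′` (`EtaleTower.IsCompat`), a monic `P ∈ (S 0)[X]` with separable
  reduction and a root `θ ∈ k′` through `ψ 0`, such that below the horizon `M` every residue is a polynomial in `θ` with coefficients from `S 0`
  (`…EtaleTowerChain.exists_monic_lift_primitive_of_isSeparable` at `κ(S M)/κ(S 0)`).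
Nothing here is a statement of H. Hironaka's manuscript [Hironaka2017]. AI-written; AI review is weaker than expert review. [folklore]
-/

set_option linter.dupNamespace false

noncomputable section

namespace Summit.ResolutionOfSingularities.ResolutionOfSingularities.Theorems.SwitchingDichotomy.EtaleTower

open IsLocalRing Polynomial Literature.AlgebraicGeometry.Resolution
open Summit.ResolutionOfSingularities.ResolutionOfSingularities.Theorems.SwitchingDichotomy.EtaleLift

/-! ## §1 Field lemmas -/

/-- A field extension with SURJECTIVE structure map is finite and separable. [folklore] -/
theorem finite_and_isSeparable_of_surjective {F E : Type} [Field F] [Field E] [Algebra F E]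
    (h : Function.Surjective (algebraMap F E)) : Module.Finite F E ∧ Algebra.IsSeparable F E := by
  let e : F ≃ₐ[F] E := AlgEquiv.ofBijective (Algebra.ofId F E) ⟨(algebraMap F E).injective, h⟩
  exact ⟨Module.Finite.equiv e.toLinearEquiv, AlgEquiv.Algebra.isSeparable e⟩

/-- **Odd degree ⟹ separable, in characteristic 2**: an inseparable irreducible polynomial over a field of characteristic `2` is a polynomial in
`X²` (`Polynomial.separable_or`), hence of even degree; the degree of a minimal polynomial divides `[E : F]`. [folklore] -/
theorem isSeparable_of_odd_finrank {F E : Type} [Field F] [Field E] [Algebra F E] [CharP F 2] [FiniteDimensional F E]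
    (hodd : Odd (Module.finrank F E)) : Algebra.IsSeparable F E := by
  refine ⟨fun x => ?_⟩
  have hint : IsIntegral F x := Algebra.IsIntegral.isIntegral x
  rcases Polynomial.separable_or 2 (minpoly.irreducible hint) with h | ⟨-, g, -, hg⟩
  · exact h
  · exfalso
    have hdvd : (minpoly F x).natDegree ∣ Module.finrank F E := by
      rw [← IntermediateField.adjoin.finrank hint]
      exact ⟨_, (Module.finrank_mul_finrank F (IntermediateField.adjoin F {x}) E).symm⟩
    have h2 : 2 ∣ (minpoly F x).natDegree := ⟨g.natDegree, by rw [← hg, Polynomial.natDegree_expand, mul_comm]⟩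
    exact Nat.not_even_iff_odd.mpr hodd (even_iff_two_dvd.mpr (h2.trans hdvd))

/-- **A residue basis of size `q`**: for a dominated inclusion of local subrings `S₀ ≤ S₁ ⊆ L` and `u : Fin q → S₁` whose residues are independent
and spanning over `κ(S₀)` (in the lifted form of the K3ᴳ word), `κ(S₁)` is finite of degree `q` over `κ(S₀)` (Mathlib's residue-field algebra of the
local inclusion). [folklore] -/
theorem finite_and_finrank_of_residue_basis {L : Type} [Field L] {S₀ S₁ : Subring L} [IsLocalRing S₀] [IsLocalRing S₁] (hle : S₀ ≤ S₁)
    (hdom : SubringDominates S₀ S₁) {q : ℕ} (u : Fin q → S₁)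
    (hind : ∀ a : Fin q → S₀, (∑ i, (⟨((a i : S₀) : L), hle (a i).2⟩ : S₁) * u i) ∈ maximalIdeal S₁ → ∀ i, a i ∈ maximalIdeal S₀)
    (hspan : ∀ z : S₁, ∃ a : Fin q → S₀, z - ∑ i, (⟨((a i : S₀) : L), hle (a i).2⟩ : S₁) * u i ∈ maximalIdeal S₁) :
    letI := (Subring.inclusion hle).toAlgebra
    haveI : IsLocalHom (algebraMap S₀ S₁) := isLocalHom_inclusion_of_subringDominates hdom
    Module.Finite (ResidueField S₀) (ResidueField S₁) ∧ Module.finrank (ResidueField S₀) (ResidueField S₁) = q := by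
  classical
  letI := (Subring.inclusion hle).toAlgebra
  haveI : IsLocalHom (algebraMap S₀ S₁) := isLocalHom_inclusion_of_subringDominates hdom
  -- the residues of the `u i`
  let ub : Fin q → ResidueField S₁ := fun i => residue S₁ (u i)
  have hsum : ∀ a : Fin q → S₀, residue S₁ (∑ i, (⟨((a i : S₀) : L), hle (a i).2⟩ : S₁) * u i) =
      ∑ i, algebraMap (ResidueField S₀) (ResidueField S₁) (residue S₀ (a i)) * ub i := fun a => by
    rw [map_sum]
    refine Finset.sum_congr rfl fun i _ => ?_
    rw [map_mul, IsLocalRing.ResidueField.algebraMap_residue]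
    rfl
  have hli : LinearIndependent (ResidueField S₀) ub := by
    rw [Fintype.linearIndependent_iff]
    intro c hc i
    -- lift the coefficients
    choose a ha using fun i => residue_surjective (c i)
    have hmem : (∑ i, (⟨((a i : S₀) : L), hle (a i).2⟩ : S₁) * u i) ∈ maximalIdeal S₁ := by
      rw [← residue_eq_zero_iff, hsum]
      simp_rw [ha, ← Algebra.smul_def]
      exact hc
    have hi := hind a hmem i
    rw [← ha i, residue_eq_zero_iff]
    exact hi
  have hsp : ⊤ ≤ Submodule.span (ResidueField S₀) (Set.range ub) := by
    rintro z -
    obtain ⟨z, rfl⟩ := residue_surjective z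
    obtain ⟨a, ha⟩ := hspan z
    have hz : residue S₁ z = ∑ i, algebraMap (ResidueField S₀) (ResidueField S₁) (residue S₀ (a i)) * ub i := by
      rw [← hsum, ← sub_eq_zero, ← map_sub, residue_eq_zero_iff]
      exact ha
    rw [hz]
    refine Submodule.sum_mem _ fun i _ => ?_
    rw [← Algebra.smul_def]
    exact Submodule.smul_mem _ _ (Submodule.subset_span ⟨i, rfl⟩)
  let B : Module.Basis (Fin q) (ResidueField S₀) (ResidueField S₁) := Module.Basis.mk hli hsp
  exact ⟨Module.Finite.of_basis B, by rw [Module.finrank_eq_card_basis B, Fintype.card_fin]⟩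

/-! ## §2 The residue tower of a chain with steps «rational ∨ residue basis of size 3» -/

section Chain

variable {L : Type} [Field L] [CharP L 2] (S : ℕ → Subring L) [∀ m, IsLocalRing (S m)]
  (hle : ∀ m, S m ≤ S (m + 1)) (hdom : ∀ m, SubringDominates (S m) (S (m + 1)))
  (hstep : ∀ m, (∀ z : S (m + 1), ∃ s : S m, z - ⟨(s : L), hle m s.2⟩ ∈ maximalIdeal (S (m + 1))) ∨
    ∃ u : Fin 3 → S (m + 1),
      (∀ a : Fin 3 → S m, (∑ i, (⟨((a i : S m) : L), hle m (a i).2⟩ : S (m + 1)) * u i) ∈ maximalIdeal (S (m + 1)) →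
        ∀ i, a i ∈ maximalIdeal (S m)) ∧
      (∀ z : S (m + 1), ∃ a : Fin 3 → S m, z - ∑ i, (⟨((a i : S m) : L), hle m (a i).2⟩ : S (m + 1)) * u i ∈ maximalIdeal (S (m + 1))))

include hstep

/-- **One step**: `κ(S (m+1))/κ(S m)` is finite separable. [folklore] -/
theorem finite_isSeparable_residueField_step (m : ℕ) :
    letI := (Subring.inclusion (hle m)).toAlgebra
    haveI : IsLocalHom (algebraMap (S m) (S (m + 1))) := isLocalHom_inclusion_of_subringDominates (hdom m)
    Module.Finite (ResidueField (S m)) (ResidueField (S (m + 1))) ∧ Algebra.IsSeparable (ResidueField (S m)) (ResidueField (S (m + 1))) := by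
  letI := (Subring.inclusion (hle m)).toAlgebra
  haveI : IsLocalHom (algebraMap (S m) (S (m + 1))) := isLocalHom_inclusion_of_subringDominates (hdom m)
  haveI : Fact (Nat.Prime 2) := ⟨Nat.prime_two⟩
  haveI : CharP (ResidueField (S m)) 2 := RadicandCohenFrame.charP_residueField 2
  rcases hstep m with hrat | ⟨u, hind, hspan⟩
  · -- rational step: the structure map is surjective
    refine finite_and_isSeparable_of_surjective (F := ResidueField (S m)) (E := ResidueField (S (m + 1))) fun z => ?_
    obtain ⟨z, rfl⟩ := residue_surjective z
    obtain ⟨s, hs⟩ := hrat z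
    refine ⟨residue (S m) s, ?_⟩
    rw [IsLocalRing.ResidueField.algebraMap_residue, ← sub_eq_zero, ← map_sub, residue_eq_zero_iff]
    have : algebraMap (S m) (S (m + 1)) s - z = -(z - ⟨(s : L), hle m s.2⟩) := by
      rw [neg_sub]; rfl
    rw [this]
    exact neg_mem hs
  · -- residue basis of size 3: degree 3 is odd
    obtain ⟨hfin, hrank⟩ := finite_and_finrank_of_residue_basis (hle m) (hdom m) u hind hspan
    haveI := hfin
    exact ⟨hfin, isSeparable_of_odd_finrank (F := ResidueField (S m)) (E := ResidueField (S (m + 1))) (by rw [hrank]; decide)⟩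

/-- **The residue tower**: `κ(S (m+1))/κ(S 0)` is finite separable for every `m`. [folklore] -/
theorem finite_isSeparable_residueField_chain (m : ℕ) :
    letI := (Subring.inclusion (monotone_nat_of_le_succ hle (Nat.zero_le (m + 1)))).toAlgebra
    haveI : IsLocalHom (algebraMap (S 0) (S (m + 1))) :=
      isLocalHom_inclusion_of_subringDominates (dominates_of_le S hdom (Nat.zero_le (m + 1)))
    Module.Finite (ResidueField (S 0)) (ResidueField (S (m + 1))) ∧ Algebra.IsSeparable (ResidueField (S 0)) (ResidueField (S (m + 1))) := by
  induction m with
  | zero => exact finite_isSeparable_residueField_step S hle hdom hstep 0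
  | succ m ih =>
    -- the three local inclusions `S 0 → S (m+1) → S (m+2)` as algebras
    letI i₀ := (Subring.inclusion (monotone_nat_of_le_succ hle (Nat.zero_le (m + 1)))).toAlgebra
    haveI : IsLocalHom (algebraMap (S 0) (S (m + 1))) :=
      isLocalHom_inclusion_of_subringDominates (dominates_of_le S hdom (Nat.zero_le (m + 1)))
    letI i₁ := (Subring.inclusion (hle (m + 1))).toAlgebra
    haveI : IsLocalHom (algebraMap (S (m + 1)) (S (m + 1 + 1))) := isLocalHom_inclusion_of_subringDominates (hdom (m + 1))
    letI i₂ := (Subring.inclusion (monotone_nat_of_le_succ hle (Nat.zero_le (m + 1 + 1)))).toAlgebra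
    haveI : IsLocalHom (algebraMap (S 0) (S (m + 1 + 1))) :=
      isLocalHom_inclusion_of_subringDominates (dominates_of_le S hdom (Nat.zero_le (m + 1 + 1)))
    haveI : IsScalarTower (S 0) (S (m + 1)) (S (m + 1 + 1)) := IsScalarTower.of_algebraMap_eq fun _ => rfl
    obtain ⟨hfin₀, hsep₀⟩ := ih
    obtain ⟨hfin₁, hsep₁⟩ := finite_isSeparable_residueField_step S hle hdom hstep (m + 1)
    haveI := hfin₀; haveI := hsep₀; haveI := hfin₁; haveI := hsep₁
    exact ⟨Module.Finite.trans (ResidueField (S (m + 1))) (ResidueField (S (m + 1 + 1))),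
      Algebra.IsSeparable.trans (ResidueField (S 0)) (ResidueField (S (m + 1))) (ResidueField (S (m + 1 + 1)))⟩

/-! ## §3 The compatible residue maps into `κ(⨆ S m)` and the stage-A′ datum -/

/-- **The stage-A′ datum of a geometric chain.** For every horizon `M`: a field `k′`, compatible maps `ψ m : κ(S m) → k′`, a monic `P ∈ (S 0)[X]` with
separable reduction and a root `θ ∈ k′` of `P` through `ψ 0`, such that for `m < M` every residue of `S (m+1)` is `q(θ)` for some `q ∈ (S 0)[X]`.
(`k′ := κ(⨆ S m)`, `θ̄` a primitive element of the finite separable `κ(S (M+1))/κ(S 0)`, `P` a lift of its minimal polynomial.) [folklore] -/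
theorem exists_compat_root (M : ℕ) :
    ∃ (k' : Type) (_ : Field k') (ψ : ∀ m, ResidueField (S m) →+* k') (_ : IsCompat S hdom ψ) (P : (S 0)[X]) (θ : k'),
      P.Monic ∧ (P.map (residue (S 0))).Separable ∧ P.eval₂ ((ψ 0).comp (residue (S 0))) θ = 0 ∧
      ∀ m, m < M → ∀ c : S (m + 1), ∃ q : (S 0)[X],
        ψ (m + 1) (residue (S (m + 1)) c) = q.eval₂ ((ψ 0).comp (residue (S 0))) θ := by
  haveI := isLocalRing_iSup S hle hdom
  -- the compatible maps into `κ(⨆ S m)`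
  let ψ : ∀ m, ResidueField (S m) →+* ResidueField (⨆ m, S m : Subring L) := fun m =>
    haveI := isLocalHom_inclusion_of_subringDominates (dominates_iSup S hle hdom m)
    ResidueField.map (Subring.inclusion (le_iSup S m))
  have hψres : ∀ m (s : S m), ψ m (residue (S m) s) = residue _ ⟨(s : L), le_iSup S m s.2⟩ := fun m s => by
    haveI := isLocalHom_inclusion_of_subringDominates (dominates_iSup S hle hdom m)
    exact ResidueField.map_residue _ _
  have hψ : IsCompat S hdom ψ := by
    intro m
    haveI := isLocalHom_inclusion_of_subringDominates (hdom m)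
    refine RingHom.ext fun z => ?_
    obtain ⟨s, rfl⟩ := residue_surjective z
    rw [RingHom.comp_apply, ResidueField.map_residue, hψres, hψres]
    rfl
  -- stage A′ at `κ(S (M+1))/κ(S 0)`
  letI := (Subring.inclusion (monotone_nat_of_le_succ hle (Nat.zero_le (M + 1)))).toAlgebra
  haveI : IsLocalHom (algebraMap (S 0) (S (M + 1))) :=
    isLocalHom_inclusion_of_subringDominates (dominates_of_le S hdom (Nat.zero_le (M + 1)))
  obtain ⟨hfin, hsepM⟩ := finite_isSeparable_residueField_chain S hle hdom hstep M
  haveI := hfin; haveI := hsepM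
  obtain ⟨P, θb, hPmon, -, hsep, hθb, hprim⟩ := exists_monic_lift_primitive_of_isSeparable (R₀ := S 0) (κ := ResidueField (S (M + 1)))
  -- the composite `κ(S 0) → κ(S (M+1)) → κ(⨆ S m)` is `ψ 0`
  have hcomp : (ψ (M + 1)).comp ((algebraMap (ResidueField (S 0)) (ResidueField (S (M + 1)))).comp (residue (S 0))) =
      (ψ 0).comp (residue (S 0)) := by
    ext s
    rw [RingHom.comp_apply, RingHom.comp_apply, IsLocalRing.ResidueField.algebraMap_residue, RingHom.comp_apply, hψres, hψres]
    rfl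
  refine ⟨_, inferInstance, ψ, hψ, P, ψ (M + 1) θb, hPmon, hsep, ?_, fun m hm c => ?_⟩
  · have h := congrArg (ψ (M + 1)) hθb
    rwa [Polynomial.hom_eval₂, hcomp, map_zero] at h
  · obtain ⟨q, hq⟩ := hprim (residue (S (M + 1)) ⟨(c : L), monotone_nat_of_le_succ hle (by omega : m + 1 ≤ M + 1) c.2⟩)
    refine ⟨q, ?_⟩
    have h := congrArg (ψ (M + 1)) hq
    rw [Polynomial.hom_eval₂, hcomp, hψres] at h
    rw [hψres, ← h]

end Chain

end Summit.ResolutionOfSingularities.ResolutionOfSingularities.Theorems.SwitchingDichotomy.EtaleTower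

end
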